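import Summits.BirchSwinnertonDyer.Rank1Residual.Supersingular.KobayashiMainConjectureX7FouquetWan
import HarnessLib

/-!
# Route `SignedLowerHalves`, crux `KobayashiLowerHalfLargeImage` (item stmt-BirchSwinnertonDyer-19001): the
# registered stub `stub_fwLocus` in EITHER analytic rank, VERBATIM, closed MODULO the OPEN binder
# «Fouquet–Wan Thm 5.1 ∘ Kobayashi Thm 7.4» (cell `bsd-ssimc`, seat `bsd-ssimc-lev` gen 5, order W-lev-9;
# a `--supports … --as helper` file, closes nothing)

PARTITION (cell bsd-ssimc): X7 (A7) × the Fouquet–Wan locus (1 004 of the 1 417 open X7 pairs of the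
cell window, both ranks, all of surjective image) — types-the-object-of; closes NONE. THEOREMS ONLY.

Companion of `SignedLowerHalvesKobayashiLowerHalfLargeImageFWLocus.lean` (p413725: the rank-0 part of the
stub via the Literature binder `FouquetWan2021.cor54_pPart_rankZero_OPEN` and the BSD detour). Here the stub
is obtained for BOTH ranks at once from the Summits-side binder
`FouquetWan2021_thm51_via_kobayashi74_OPEN` (`Supersingular/KobayashiMainConjectureX7FouquetWan.lean`,
p414007): Fouquet–Wan arXiv:2107.13726 Thm 5.1 (PRE: Kato's main conjecture for `M(f_E)` on the locus) read
through Kobayashi 2003 Thm 7.4 (PUB: at `a_p = 0` Kato's main conjecture ⇔ each signed main conjecture).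
The statement below is the planner's registered stub header VERBATIM (BC3 skeleton
`Cruxes/KobayashiLowerHalfLargeImage/Lines/birth.lean`) with ONE extra leading binder, the OPEN claim; so
`stub_fwLocus` is «PRE-closable» in the precise sense of the seat's audit MEMO-5 + addA/addB/addC
(HOME/bsd-ssimc-lev/): no located obstruction at statement level; proof-level items A-SC-2 (dyadic
supercuspidal of even level ≥ 4; 86–88 pairs) and A-KATO-3 (p = 3) recorded there. Nothing is booked; the
crux stays OPEN on the ledger.

References: [FouquetWan2021] Thm 5.1 (PRE); [Kobayashi2003] Thm 7.4 (p. 13), Conjecture (p. 2).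
-/

set_option autoImplicit false
set_option linter.dupNamespace false

noncomputable section

open scoped Classical MatrixGroups ModularForm

open CongruenceSubgroup WeierstrassCurve Literature.NumberTheory.EllipticCurves
  Literature.NumberTheory.EllipticCurves.ModularForms
  Literature.NumberTheory.EllipticCurves.Rank1Residual
  Summit.BirchSwinnertonDyer.Rank1Residual.Supersingular

namespace Summit.BirchSwinnertonDyer.BirchSwinnertonDyer.Theorems

/-- **`stub_fwLocus` (verbatim header) MODULO the OPEN binder «FW Thm 5.1 ∘ Kobayashi Thm 7.4».** For every
globally minimal `W/ℚ` and odd prime `p` with `ClassX7 W p`, `¬CM`, `a_p = 0`, `ρ̄_{E,p}` onto and a prime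
`ℓ ≠ p` of NON-SPLIT multiplicative reduction with `p ∤ ord_ℓ(Δ_min)`: IF `FouquetWan2021_thm51_via_kobayashi74_OPEN`
holds (`hFW`, the Fouquet–Wan half UNREFEREED), then `∃ ε, KobayashiLowerDivisibility W p ε` (indeed the full
main conjecture for both signs: `X7.kobayashiLowerDivisibility_of_thm51_OPEN`). The binders `¬CM` and `Surj`
of the stub are carried unused (FW need only `E[p]` irreducible, which is Serre's Prop 12 on X7).
CONDITIONAL; closes nothing. [claim: FouquetWan2021, status: under-review]
[cite: Kobayashi2003, Thm. 7.4 (p. 13) and Conjecture (p. 2)] -/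
theorem stub_fwLocus_of_thm51_OPEN (hFW : FouquetWan2021_thm51_via_kobayashi74_OPEN) :
    ∀ (W : WeierstrassCurve ℚ) [W.IsElliptic] [W.IsGloballyMinimal] (p : ℕ) [Fact p.Prime],
      p ≠ 2 → ClassX7 W p → ¬ W.HasCM → W.frobeniusTrace p = 0 → Surj W p →
      (∃ ℓ : ℕ, ∃ _ : Fact ℓ.Prime, ℓ ≠ p ∧ W.HasMultiplicativeReductionAtPrime ℓ ∧
          ¬ W.HasSplitMultiplicativeReductionAtPrime ℓ ∧ ¬ p ∣ padicValInt ℓ W.minimalDiscriminantInt) →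
      ∃ ε : ℤˣ, Summit.BirchSwinnertonDyer.Rank1Residual.Supersingular.KobayashiLowerDivisibility W p ε := by
  intro W _ _ p _ hp hX _hcm hap _hs hloc
  exact X7.kobayashiLowerDivisibility_of_thm51_OPEN W p hFW hp hX hap hloc

/-- **The whole FW locus of corner X7, analytic rank ≤ 1: `BSD(E,p)` MODULO the OPEN binder**, by cases on
the rank — rank 1 via Burungale–Kobayashi–Ota 2024 Cor A.5 (`hA5`), rank 0 via the image-free ± road
(Kobayashi Thm 1.2 `h12`, B. D. Kim Cor 3.15 `hKim`, Pollack `hPollack`, modularity `hmod`/`hmod'`), GZK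
(`hGZK`) in both. This is what «PRE-closable» buys on the 1 004 locus pairs (917 rank 1 + 87 rank 0) the day
the binder is discharged. CONDITIONAL; closes nothing. [claim: FouquetWan2021, status: under-review]
[cite: BurungaleKobayashiOta2023, App. A Cor. A.5] [cite: Kobayashi2003, Thm. 1.2 and Thm. 7.4]
[cite: BDKim2013, Cor. 3.15 (p. 199)] [cite: Miller2011LMS, §1 and Def. 1.1] -/
theorem X7_bsdp_of_thm51_OPEN_of_fwLocus_of_analyticRank_le_one
    (hFW : FouquetWan2021_thm51_via_kobayashi74_OPEN)
    (hA5 : BurungaleKobayashiOta2024.corA5_pPart_of_signedCharIdeal_eq)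
    (h12 : Kobayashi2003.thm12_signedSelmerDual_finite_torsion)
    (hKim : BDKim2013.cor315_signedCharValue_rankZero)
    (hmod : nonempty_modularParametrizationData) (hmod' : hasEntireLFunction_rat)
    (hGZK : rank_eq_analyticRank_of_analyticRank_le_one)
    (W : WeierstrassCurve ℚ) [W.IsElliptic] [W.IsGloballyMinimal] (p : ℕ) [Fact p.Prime]
    (hPollack : ∀ {N : ℕ} [NeZero N] {f : CuspForm (Gamma0 N) 2},
      pollack_exists_plusMinusPAdicLFunction (W := W) (f := f) (p := p))
    (hp : p ≠ 2) (hX : ClassX7 W p) (hap : W.frobeniusTrace p = 0)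
    (hloc : ∃ (ℓ : ℕ) (_ : Fact ℓ.Prime), ℓ ≠ p ∧ W.HasMultiplicativeReductionAtPrime ℓ ∧
        ¬ W.HasSplitMultiplicativeReductionAtPrime ℓ ∧ ¬ p ∣ padicValInt ℓ W.minimalDiscriminantInt)
    (hr : W.analyticRank ≤ 1) : BSDp W p := by
  rcases Nat.lt_or_ge W.analyticRank 1 with h0 | h1
  · exact X7.bsdp_of_thm51_OPEN_of_analyticRank_eq_zero W p hFW h12 hKim hPollack hmod hmod' hGZK hp hX hap
      hloc (Nat.lt_one_iff.mp h0)
  · exact X7.bsdp_of_thm51_OPEN_of_corA5_of_analyticRank_eq_one W p hFW hA5 hmod' hGZK hp hX hap hloc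
      (le_antisymm hr h1)

end Summit.BirchSwinnertonDyer.BirchSwinnertonDyer.Theorems

end
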